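import Summits.ResolutionOfSingularities.ResolutionOfSingularities.Theorems.PrimaryDeepSurfaceChart
import HarnessLib

/-!
# Primary deep cut — SURFACE PRESENTATION (lens-4 g47, node «PrimaryDeepCut», slice S4)

(D1) over a REGULAR local ring `R` with regular system of parameters `z` (first `c` members = the surface equations
`𝔭`, last two = the surface parameters `c̄`): the strict transform ideal `𝔭' = (e_s : s < c)·L` of the surface in a
prime-localised `z_j`-chart `L` (`j = c + jb`) is prime and misses the exceptional parameter, the surface quotient map
`R/𝔭 → L/𝔭'` is injective, and `L/𝔭'` is PRESENTED as a prime-localisation of the `c̄_jb`-chart of the point blow-up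
of the surface `R/𝔭` by an injective map `ψ` compatible with `σ` (`exists_surfaceChart_presentation`).
-/

set_option linter.dupNamespace false

open CategoryTheory CategoryTheory.Limits AlgebraicGeometry TopologicalSpace IsLocalRing
open MvPolynomial Literature.AlgebraicGeometry.Resolution Scheme.IdealSheafData
open Summit.ResolutionOfSingularities.ResolutionOfSingularities.Theorems
open ForcedTowerClasses DivergentTowerClasses MonomialTowerClasses
open HugDimensionClasses SurfaceShadowClasses SurfaceShadowKernels AbsoluteContactClasses
open Summit.ResolutionOfSingularities.ResolutionOfSingularities.Theses

universe u

namespace Summit.ResolutionOfSingularities.ResolutionOfSingularities.Theorems.HugValuationCut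

section SurfacePresentation

variable {R : Type u} [CommRing R] {c : ℕ} (z : Fin (c + 2) → R) (jb : Fin 2)
  (L : Type u) [CommRing L] [Algebra (chartRing z (Fin.natAdd c jb)) L]

/-! ## §1 The surface chart over a REGULAR local ring: primality of `𝔭' = (e_s : s < c)`, injectivity of
`R/𝔭 → L/𝔭'`, and the presentation `ψ : chartRing c̄ jb → L/𝔭'` -/

section Regular

variable [IsRegularLocalRing R] (hz : Ideal.span (Set.range z) = maximalIdeal R)
  (hd : (maximalIdeal R).spanFinrank = c + 2) (𝔴 : Ideal (chartRing z (Fin.natAdd c jb))) [𝔴.IsPrime]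
  (h𝔴 : 𝔴.comap (chartBase z (Fin.natAdd c jb)) = maximalIdeal R)
  (h𝔴u : ∀ s : Fin c, chartGen z (Fin.natAdd c jb) (Fin.castAdd 2 s) ∈ 𝔴)
  [IsLocalRing L] [IsLocalization.AtPrime L 𝔴]

include hz hd in
/-- the full family `z` is a regular system of parameters. [cite: Matsumura1987, Thm. 14.2] -/
theorem isRsopPart_full : IsRsopPart z := by
  have h0 : Ideal.span (Set.range (Fin.append z (fun i : Fin 0 => i.elim0))) = maximalIdeal R := by
    rw [range_fin_append, Set.range_eq_empty (fun i : Fin 0 => _), Set.union_empty, hz]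
  exact isRsopPart_centre z (fun i : Fin 0 => i.elim0) h0 hd

include hz hd h𝔴 h𝔴u in
/-- **`𝔭' = (e_s : s < c)·L` is prime and misses the exceptional parameter `g = σ(z_j)`.**
[cite: StacksProject, Tag 0BIQ] [cite: Matsumura1987, Thm. 14.2] -/
theorem surfaceChart_isPrime :
    (surfTransformIdeal z jb L).IsPrime ∧
      (algebraMap (chartRing z (Fin.natAdd c jb)) L : chartRing z (Fin.natAdd c jb) →+* L)
        (chartBase z (Fin.natAdd c jb) (z (Fin.natAdd c jb))) ∉ surfTransformIdeal z jb L := by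
  rw [surfTransformIdeal_def]
  have hd0 : (maximalIdeal R).spanFinrank = (c + 2) + 0 := hd
  have h0 : Ideal.span (Set.range (Fin.append z (fun i : Fin 0 => i.elim0))) = maximalIdeal R := by
    rw [range_fin_append, Set.range_eq_empty (fun i : Fin 0 => _), Set.union_empty, hz]
  have h := isPrime_span_chartGen_of_subset z (Fin.natAdd c jb) (fun i : Fin 0 => i.elim0)
    h0 hd0 𝔴 h𝔴 L (Set.range (Fin.castAdd 2 : Fin c → Fin (c + 2)))
    (natAdd_not_mem_range_castAdd jb) (by rintro _ ⟨s, rfl⟩; exact h𝔴u s)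
  have hset : (fun t => (algebraMap (chartRing z (Fin.natAdd c jb)) L : chartRing z (Fin.natAdd c jb) →+* L) (chartGen z (Fin.natAdd c jb) t)) ''
      Set.range (Fin.castAdd 2 : Fin c → Fin (c + 2)) =
      Set.range (fun s : Fin c =>
        (algebraMap (chartRing z (Fin.natAdd c jb)) L : chartRing z (Fin.natAdd c jb) →+* L) (chartGen z (Fin.natAdd c jb) (Fin.castAdd 2 s))) := by
    rw [← Set.range_comp]; rfl
  rw [hset] at h
  exact h

include hz hd h𝔴 h𝔴u in
set_option maxHeartbeats 400000 in -- WRITER NOTE (g16): pre-budgeted (elaboration exceeds 100k = half the tree default; ops-buildfix standing ask)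
/-- **The surface `R/𝔭` embeds into its strict transform `L/𝔭'`**: `σ(f) ∈ 𝔭'` forces `f ∈ 𝔭 = (z_s : s < c)`.
(Test against the chart over the fraction field of `R/𝔭`, `chartToField`: it kills the `e_s`, `s < c`, and is
non-zero on elements outside `𝔴`.) [cite: HerrmannIkedaOrbanz1988, Thm. (30.2)] [cite: StacksProject, Tag 0804] -/
theorem mem_surfIdeal_of_map_mem {f : R}
    (hf : (algebraMap (chartRing z (Fin.natAdd c jb)) L : chartRing z (Fin.natAdd c jb) →+* L)
      (chartBase z (Fin.natAdd c jb) f) ∈ surfTransformIdeal z jb L) :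
    f ∈ surfIdeal z := by
  classical
  obtain ⟨hP, hg⟩ := surfaceChart_isPrime z jb L hz hd 𝔴 h𝔴 h𝔴u
  rw [surfTransformIdeal_def] at hP hg hf
  rw [surfIdeal_def]
  set aL : chartRing z (Fin.natAdd c jb) →+* L :=
    (algebraMap (chartRing z (Fin.natAdd c jb)) L : chartRing z (Fin.natAdd c jb) →+* L) with haL
  set 𝔭 : Ideal R := Ideal.span (Set.range (z ∘ Fin.castAdd 2)) with h𝔭def
  set 𝔔 : Ideal (chartRing z (Fin.natAdd c jb)) := Ideal.span (Set.range fun s : Fin c => chartGen z (Fin.natAdd c jb) (Fin.castAdd 2 s)) with h𝔔def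
  have hzr : IsRsopPart z := isRsopPart_full z hz hd
  haveI h𝔭P : 𝔭.IsPrime := (hzr.comp (Fin.castAdd 2) (Fin.castAdd_injective _ _)).isPrime_span_range
  have hzj : z (Fin.natAdd c jb) ∉ 𝔭 := by
    have h := hzr.not_mem_span_image (natAdd_not_mem_range_castAdd jb)
    rwa [← Set.range_comp] at h
  haveI : IsDomain (R ⧸ 𝔭) := (Ideal.Quotient.isDomain_iff_prime 𝔭).mpr h𝔭P
  -- the test map `θ₀ : R → Frac(R/𝔭)` and its chart extension `θ₁`
  set θ₀ : R →+* FractionRing (R ⧸ 𝔭) := (algebraMap (R ⧸ 𝔭) (FractionRing (R ⧸ 𝔭))).comp (Ideal.Quotient.mk 𝔭)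
    with hθ₀def
  have hθ₀mem : ∀ r, θ₀ r = 0 ↔ r ∈ 𝔭 := fun r => by
    rw [hθ₀def, RingHom.comp_apply, ← Ideal.Quotient.eq_zero_iff_mem]
    exact ⟨fun h => IsFractionRing.injective (R ⧸ 𝔭) (FractionRing (R ⧸ 𝔭)) (by rw [h, map_zero]),
      fun h => by rw [h, map_zero]⟩
  have hθ₀ : θ₀ (z (Fin.natAdd c jb)) ≠ 0 := fun h => hzj ((hθ₀mem _).mp h)
  have h𝔔 : 𝔔 ≤ RingHom.ker (chartToField z (Fin.natAdd c jb) θ₀ hθ₀) := by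
    rw [h𝔔def, Ideal.span_le]
    rintro _ ⟨s, rfl⟩
    rw [SetLike.mem_coe, RingHom.mem_ker, chartToField_chartGen,
      (hθ₀mem (z (Fin.castAdd 2 s))).mpr (Ideal.subset_span ⟨s, rfl⟩), zero_div]
  -- from `hf`: an element `t ∉ 𝔴` with `t · φ(f) ∈ 𝔔`
  have h𝔭'eq : Ideal.span (Set.range fun s : Fin c => aL (chartGen z (Fin.natAdd c jb) (Fin.castAdd 2 s))) = 𝔔.map aL := by
    rw [h𝔔def, Ideal.map_span, ← Set.range_comp]; rfl
  rw [h𝔭'eq, IsLocalization.mem_map_algebraMap_iff 𝔴.primeCompl L] at hf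
  obtain ⟨⟨⟨q, hq⟩, ⟨t₀, ht₀⟩⟩, hqt⟩ := hf
  have hqt' : aL (chartBase z (Fin.natAdd c jb) f * t₀) = aL q := by rw [map_mul]; exact hqt
  obtain ⟨⟨c₁, hc₁⟩, hc⟩ := IsLocalization.exists_of_eq (M := 𝔴.primeCompl) hqt'
  have ht : c₁ * t₀ ∉ 𝔴 := fun h => (‹𝔴.IsPrime›.mem_or_mem h).elim hc₁ ht₀
  have hmem : c₁ * t₀ * chartBase z (Fin.natAdd c jb) f ∈ 𝔔 := by
    have h1 : c₁ * t₀ * chartBase z (Fin.natAdd c jb) f = c₁ * q := by rw [← hc]; ring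
    rw [h1]; exact 𝔔.mul_mem_left _ hq
  have h0 : chartToField z (Fin.natAdd c jb) θ₀ hθ₀ (c₁ * t₀) * θ₀ f = 0 := by
    rw [← chartToField_reesChartBase z (Fin.natAdd c jb) θ₀ hθ₀ f, ← map_mul]; exact h𝔔 hmem
  rcases mul_eq_zero.mp h0 with h1 | h1
  · -- `θ₁(c₁ t₀) = 0` would put `c₁ t₀` in `𝔴`
    exfalso
    apply ht
    obtain ⟨k, r, hkr⟩ := exists_pow_mul_eq_reesChartBase z (Fin.natAdd c jb) (c₁ * t₀)
    have hr : r ∈ 𝔭 := by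
      rw [← hθ₀mem, ← chartToField_reesChartBase z (Fin.natAdd c jb) θ₀ hθ₀ r, ← hkr, map_mul, h1, mul_zero]
    have hσr : aL (chartBase z (Fin.natAdd c jb) r) ∈ Ideal.span {aL (chartBase z (Fin.natAdd c jb) (z (Fin.natAdd c jb)))} *
        Ideal.span (Set.range fun s : Fin c => aL (chartGen z (Fin.natAdd c jb) (Fin.castAdd 2 s))) := by
      have hle : 𝔭.map (aL.comp (chartBase z (Fin.natAdd c jb))) ≤ Ideal.span {aL (chartBase z (Fin.natAdd c jb) (z (Fin.natAdd c jb)))} *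
          Ideal.span (Set.range fun s : Fin c => aL (chartGen z (Fin.natAdd c jb) (Fin.castAdd 2 s))) := by
        rw [h𝔭def, Ideal.map_span, Ideal.span_le]
        rintro _ ⟨_, ⟨s, rfl⟩, rfl⟩
        rw [SetLike.mem_coe, RingHom.comp_apply, Function.comp_apply,
          reesChartBase_apply_eq_mul_chartGen z (Fin.natAdd c jb) (Fin.castAdd 2 s), map_mul]
        exact Ideal.mul_mem_mul (Ideal.mem_span_singleton_self _)
          (Ideal.subset_span (s := Set.range fun s : Fin c => aL (chartGen z (Fin.natAdd c jb) (Fin.castAdd 2 s)))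
            (Set.mem_range_self s))
      exact hle (Ideal.mem_map_of_mem _ hr)
    rw [← hkr, map_mul] at hσr
    haveI := hP
    have h2 : aL (c₁ * t₀) ∈ Ideal.span (Set.range fun s : Fin c => aL (chartGen z (Fin.natAdd c jb) (Fin.castAdd 2 s))) :=
      (hP.mem_or_mem (Ideal.mul_le_left hσr)).resolve_left fun h =>
        hg (Ideal.mem_comap.mp (Ideal.IsPrime.mem_of_pow_mem (I := Ideal.comap aL _) inferInstance k h))
    have h𝔭'le : Ideal.span (Set.range fun s : Fin c => aL (chartGen z (Fin.natAdd c jb) (Fin.castAdd 2 s))) ≤ maximalIdeal L := by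
      rw [Ideal.span_le]
      rintro _ ⟨s, rfl⟩
      exact (IsLocalization.AtPrime.to_map_mem_maximal_iff L 𝔴 _).mpr (h𝔴u s)
    exact (IsLocalization.AtPrime.to_map_mem_maximal_iff L 𝔴 _).mp (h𝔭'le h2)
  · exact (hθ₀mem f).mp h1

include hz hd h𝔴 h𝔴u in
/-- `σ̄ : R/𝔭 → L/𝔭'` is injective (Theorem C repackaged). [cite: HerrmannIkedaOrbanz1988, Thm. (30.2)] -/
theorem surfQuotientMap_injective :
    Function.Injective (Ideal.quotientMap (surfTransformIdeal z jb L)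
      (((algebraMap (chartRing z (Fin.natAdd c jb)) L : chartRing z (Fin.natAdd c jb) →+* L).comp
        (chartBase z (Fin.natAdd c jb)))) (surfIdeal_le_comap z jb L)) := by
  intro x y hxy
  obtain ⟨r, rfl⟩ := Ideal.Quotient.mk_surjective x
  obtain ⟨s, rfl⟩ := Ideal.Quotient.mk_surjective y
  rw [Ideal.quotientMap_mk, Ideal.quotientMap_mk, Ideal.Quotient.eq, ← map_sub] at hxy
  exact Ideal.Quotient.eq.mpr (mem_surfIdeal_of_map_mem z jb L hz hd 𝔴 h𝔴 h𝔴u hxy)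

include hz hd h𝔴 h𝔴u in
set_option maxHeartbeats 400000 in -- WRITER NOTE (g16): pre-budgeted (elaboration exceeds 100k = half the tree default; ops-buildfix standing ask)
/-- **THE SURFACE-CHART HOMOMORPHISM.** There is an injective ring map `ψ : chartRing c̄ jb → L/𝔭'` from the
`c̄_jb`-chart of the surface `R/𝔭` to the strict transform, compatible with the structure maps and with the chart
generators (`ψ(ē_i) = e_{c+i} mod 𝔭'`).  (`ψ` is the chart over the fraction field of the domain `L/𝔭'`,
`chartToField`, whose range lies in `L/𝔭'` because its generators do.)
[cite: HerrmannIkedaOrbanz1988, Thm. (30.2)] [cite: StacksProject, Tag 0804] -/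
theorem exists_surfaceChart_hom :
    ∃ ψ : chartRing (surfParam z) jb →+* L ⧸ surfTransformIdeal z jb L,
      (∀ r : R, ψ (chartBase (surfParam z) jb (Ideal.Quotient.mk _ r)) =
        Ideal.Quotient.mk _ ((algebraMap (chartRing z (Fin.natAdd c jb)) L : chartRing z (Fin.natAdd c jb) →+* L)
          (chartBase z (Fin.natAdd c jb) r))) ∧
      (∀ i : Fin 2, ψ (chartGen (surfParam z) jb i) =
        Ideal.Quotient.mk _ ((algebraMap (chartRing z (Fin.natAdd c jb)) L : chartRing z (Fin.natAdd c jb) →+* L)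
          (chartGen z (Fin.natAdd c jb) (Fin.natAdd c i)))) ∧
      Function.Injective ψ := by
  classical
  obtain ⟨hP, hg⟩ := surfaceChart_isPrime z jb L hz hd 𝔴 h𝔴 h𝔴u
  set aL : chartRing z (Fin.natAdd c jb) →+* L :=
    (algebraMap (chartRing z (Fin.natAdd c jb)) L : chartRing z (Fin.natAdd c jb) →+* L) with haL
  haveI : IsDomain (L ⧸ surfTransformIdeal z jb L) := (Ideal.Quotient.isDomain_iff_prime _).mpr hP
  -- `σ̄ : R/𝔭 → L/𝔭'`, injective by §1
  set σb : R ⧸ surfIdeal z →+* L ⧸ surfTransformIdeal z jb L :=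
    Ideal.quotientMap _ (aL.comp (chartBase z (Fin.natAdd c jb))) (surfIdeal_le_comap z jb L) with hσbdef
  have hσb : ∀ r, σb (Ideal.Quotient.mk _ r) = Ideal.Quotient.mk _ (aL (chartBase z (Fin.natAdd c jb) r)) :=
    fun r => Ideal.quotientMap_mk
  have hσb_inj : Function.Injective σb := surfQuotientMap_injective z jb L hz hd 𝔴 h𝔴 h𝔴u
  -- the test map `θ' : R/𝔭 → Frac(L/𝔭')`
  set ιK : L ⧸ surfTransformIdeal z jb L →+* FractionRing (L ⧸ surfTransformIdeal z jb L) :=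
    algebraMap _ _ with hιKdef
  have hιK : Function.Injective ιK := IsFractionRing.injective _ _
  set θ' : R ⧸ surfIdeal z →+* FractionRing (L ⧸ surfTransformIdeal z jb L) := ιK.comp σb with hθ'def
  have hθ'j : θ' (surfParam z jb) =
      ιK (Ideal.Quotient.mk _ (aL (chartBase z (Fin.natAdd c jb) (z (Fin.natAdd c jb))))) := by
    show ιK (σb (Ideal.Quotient.mk _ (z (Fin.natAdd c jb)))) = _
    rw [hσb]
  have hθ'i : ∀ i : Fin 2, θ' (surfParam z i) =
      ιK (Ideal.Quotient.mk _ (aL (chartBase z (Fin.natAdd c jb) (z (Fin.natAdd c jb))))) *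
        ιK (Ideal.Quotient.mk _ (aL (chartGen z (Fin.natAdd c jb) (Fin.natAdd c i)))) := fun i => by
    show ιK (σb (Ideal.Quotient.mk _ (z (Fin.natAdd c i)))) = _
    rw [hσb, reesChartBase_apply_eq_mul_chartGen z (Fin.natAdd c jb) (Fin.natAdd c i), map_mul, map_mul, map_mul]
  have hG : ιK (Ideal.Quotient.mk _ (aL (chartBase z (Fin.natAdd c jb) (z (Fin.natAdd c jb))))) ≠ 0 := by
    intro h
    exact hg (Ideal.Quotient.eq_zero_iff_mem.mp (hιK (by rw [h, map_zero])))
  have hθ' : θ' (surfParam z jb) ≠ 0 := by rw [hθ'j]; exact hG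
  -- `ψ̃ = chartToField c̄ jb θ'` takes values in `L/𝔭'`
  have hrange : ∀ b, chartToField (surfParam z) jb θ' hθ' b ∈ ιK.range := by
    intro b
    refine (Subring.closure_le.mpr ?_) (chartToField_mem_closure (surfParam z) jb θ' hθ' b)
    rintro x (⟨r, rfl⟩ | ⟨i, rfl⟩)
    · exact ⟨σb r, rfl⟩
    · refine ⟨Ideal.Quotient.mk _ (aL (chartGen z (Fin.natAdd c jb) (Fin.natAdd c i))), ?_⟩
      change ιK _ = θ' (surfParam z i) / θ' (surfParam z jb)
      rw [hθ'i, hθ'j, mul_div_cancel_left₀ _ hG]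
  obtain ⟨ψ, hψ⟩ : ∃ ψ : chartRing (surfParam z) jb →+* L ⧸ surfTransformIdeal z jb L,
      ∀ b, ιK (ψ b) = chartToField (surfParam z) jb θ' hθ' b :=
    ⟨liftOfRange (chartToField (surfParam z) jb θ' hθ') ιK hιK hrange,
      liftOfRange_spec (chartToField (surfParam z) jb θ' hθ') ιK hιK hrange⟩
  refine ⟨ψ, fun r => hιK (by rw [hψ, chartToField_reesChartBase, ← hσb]; rfl),
    fun i => hιK (by rw [hψ, chartToField_chartGen, hθ'i, hθ'j, mul_div_cancel_left₀ _ hG]), ?_⟩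
  -- injectivity (common denominators, as in `isLocalization_atPrime_ker_chartToField`)
  have hnzd : ∀ k : ℕ, chartBase (surfParam z) jb (surfParam z jb) ^ k ∈ nonZeroDivisors (chartRing (surfParam z) jb) :=
    fun k => pow_mem (reesChartBase_mem_nonZeroDivisors (surfParam z jb)
      (Ideal.mem_span_range_self (f := surfParam z) (x := jb))) k
  intro b₁ b₂ h12
  have h12' : chartToField (surfParam z) jb θ' hθ' b₁ = chartToField (surfParam z) jb θ' hθ' b₂ := by
    rw [← hψ b₁, ← hψ b₂, h12]
  obtain ⟨k₁, r₁, h₁⟩ := exists_pow_mul_eq_reesChartBase (surfParam z) jb b₁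
  obtain ⟨k₂, r₂, h₂⟩ := exists_pow_mul_eq_reesChartBase (surfParam z) jb b₂
  have h₁' : chartBase (surfParam z) jb (surfParam z jb) ^ (k₁ + k₂) * b₁ =
      chartBase (surfParam z) jb (surfParam z jb ^ k₂ * r₁) := by
    rw [RingHom.map_mul, RingHom.map_pow, ← h₁]; ring
  have h₂' : chartBase (surfParam z) jb (surfParam z jb) ^ (k₁ + k₂) * b₂ =
      chartBase (surfParam z) jb (surfParam z jb ^ k₁ * r₂) := by
    rw [RingHom.map_mul, RingHom.map_pow, ← h₂]; ring
  have h3 : θ' (surfParam z jb ^ k₂ * r₁) = θ' (surfParam z jb ^ k₁ * r₂) := by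
    rw [← chartToField_reesChartBase (surfParam z) jb θ' hθ', ← chartToField_reesChartBase (surfParam z) jb θ' hθ',
      ← h₁', ← h₂', RingHom.map_mul, RingHom.map_mul, h12']
  have h4 : surfParam z jb ^ k₂ * r₁ = surfParam z jb ^ k₁ * r₂ := hσb_inj (hιK h3)
  have h5 : chartBase (surfParam z) jb (surfParam z jb) ^ (k₁ + k₂) * b₁ =
      chartBase (surfParam z) jb (surfParam z jb) ^ (k₁ + k₂) * b₂ := by
    rw [h₁', h₂', h4]
  exact (mul_cancel_left_mem_nonZeroDivisors (hnzd _)).mp h5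

include hz hd h𝔴 h𝔴u in
/-- **THE SURFACE-CHART PRESENTATION** (new kernel). In a model `L` of the local ring of the point blow-up of a
regular local ring `R` at a point `𝔴` of the `z_j`-chart lying on the strict transform of the regular surface germ
`V(𝔭)`, `𝔭 = (z_s : s < c)`, `j = c + jb`: the strict transform `L/𝔭'` is a prime-localisation of the `c̄_jb`-chart
`chartRing c̄ jb` of the surface `R/𝔭` itself, compatibly with the structure maps and the chart generators, and
the comparison map `ψ` is injective; so every result about point blow-ups OF THE SURFACE (near points, colength
drop, order charts) applies to the strict transform inside the ambient blow-up.
[cite: HerrmannIkedaOrbanz1988, Thm. (30.2)] [cite: StacksProject, Tag 0804] [cite: Matsumura1987, Thm. 14.2] -/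
theorem exists_surfaceChart_presentation :
    ∃ (𝔴' : PrimeSpectrum (chartRing (surfParam z) jb))
      (ψ : chartRing (surfParam z) jb →+* L ⧸ surfTransformIdeal z jb L),
      (∀ r : R, ψ (chartBase (surfParam z) jb (Ideal.Quotient.mk _ r)) =
        Ideal.Quotient.mk _ ((algebraMap (chartRing z (Fin.natAdd c jb)) L : chartRing z (Fin.natAdd c jb) →+* L)
          (chartBase z (Fin.natAdd c jb) r))) ∧
      (∀ i : Fin 2, ψ (chartGen (surfParam z) jb i) =
        Ideal.Quotient.mk _ ((algebraMap (chartRing z (Fin.natAdd c jb)) L : chartRing z (Fin.natAdd c jb) →+* L)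
          (chartGen z (Fin.natAdd c jb) (Fin.natAdd c i)))) ∧
      Function.Injective ψ ∧
      (∀ r ∈ maximalIdeal R, chartBase (surfParam z) jb (Ideal.Quotient.mk _ r) ∈ 𝔴'.asIdeal) ∧
      @IsLocalization.AtPrime _ _ (L ⧸ surfTransformIdeal z jb L) _ ψ.toAlgebra 𝔴'.asIdeal _ := by
  obtain ⟨hP, -⟩ := surfaceChart_isPrime z jb L hz hd 𝔴 h𝔴 h𝔴u
  obtain ⟨ψ, hP1, hP2, hP3⟩ := exists_surfaceChart_hom z jb L hz hd 𝔴 h𝔴 h𝔴u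
  haveI : IsDomain (L ⧸ surfTransformIdeal z jb L) := (Ideal.Quotient.isDomain_iff_prime _).mpr hP
  have h𝔭'le : surfTransformIdeal z jb L ≤ maximalIdeal L := by
    rw [surfTransformIdeal_def, Ideal.span_le]
    rintro _ ⟨s, rfl⟩
    exact (IsLocalization.AtPrime.to_map_mem_maximal_iff L 𝔴 _).mpr (h𝔴u s)
  haveI hLloc : IsLocalRing (L ⧸ surfTransformIdeal z jb L) :=
    IsLocalRing.of_surjective' (Ideal.Quotient.mk _) Ideal.Quotient.mk_surjective
  refine ⟨⟨(maximalIdeal (L ⧸ surfTransformIdeal z jb L)).comap ψ, Ideal.comap_isPrime _ _⟩, ψ, hP1, hP2, hP3,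
    fun r hr => ?_, surfaceChart_isLocalization z jb L 𝔴 ψ hP3 (surfaceChart_hit z jb L ψ hP1 hP2)⟩
  change ψ _ ∈ maximalIdeal _
  rw [hP1, mk_mem_maximalIdeal_iff_of_le L h𝔭'le]
  have h1 : chartBase z (Fin.natAdd c jb) r ∈ 𝔴 := by rw [← Ideal.mem_comap, h𝔴]; exact hr
  exact (IsLocalization.AtPrime.to_map_mem_maximal_iff L 𝔴 _).mpr h1

end Regular

end SurfacePresentation

end Summit.ResolutionOfSingularities.ResolutionOfSingularities.Theorems.HugValuationCut
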